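import Summits.CriticalPhenomena.PercolationContinuityZ3.Theorems.Transplant.Bcc111ClawTableOKG
import HarnessLib

/-!
# The bcc (111)-films `F_m(bcc)`, exit-form routing certificate IIH: the first-fit rule `clawH` SUCCEEDS on the kernel class `(3, 3, 3, 3)` — chunks 5–8 and the assembly
# (kernel computation; the unclipped class, `16 398` admissible configurations in all)

builds on p205010 (kernel theorem, internal audit signed; external expert review pending) — NOT used in this file.
Lane `prim-bschramm`, seat `prim-bschramm-p2` (gen 48; class C1b, METHOD = input substitution; memo `HOME/bschramm/P2-LATTICES.md` §159); helper file
(`--supports stmt-CriticalPhenomena-4575 --as helper`).  `decide +kernel` theorems (standard axioms, default heartbeats, no `native_decide`) towards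
«Bcc111ClawTable».`ClawHOK 3 3`, in eight chunks of the column of `E₁` over the two files «Bcc111ClawTableOKG» (chunks 1–4) and «Bcc111ClawTableOKH» (chunks 5–8 and
the assembly `clawHOK_33`), evaluated in the fast order of «Bcc111ClawFast».  With «Bcc111ClawTableOK{A,…,F}» this completes the ten kernel classes
`0 ≤ s_R ≤ s_D ≤ 3` (`104 784` admissible configurations; the candidate-leg table was found by kit job `j339670` outside Lean and is only verified here).
[cite: DuminilCopinSidoraviciusTassion2016, §2.3 (proof of Fact 2: the three disjoint paths in B̄_R(z) ∖ {z})]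
-/

namespace Summit.CriticalPhenomena.PercolationContinuityZ3.Theorems.Transplant

namespace Bcc111Claw

/-- Kernel class `(3, 3, 3, 3)`, chunk 5 of the column of `E₁`: `[(0, 2), (0, 3), (1, -3), (1, -2), (1, -1)]`. [folklore] -/
theorem clawHOKLF_33_5 : ClawHOKLF 3 3 [(0, 2), (0, 3), (1, -3), (1, -2), (1, -1)] := by
  unfold ClawHOKLF; decide +kernel

/-- Kernel class `(3, 3, 3, 3)`, chunk 6 of the column of `E₁`: `[(1, 0), (1, 1), (1, 2), (2, -3)]`. [folklore] -/
theorem clawHOKLF_33_6 : ClawHOKLF 3 3 [(1, 0), (1, 1), (1, 2), (2, -3)] := by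
  unfold ClawHOKLF; decide +kernel

/-- Kernel class `(3, 3, 3, 3)`, chunk 7 of the column of `E₁`: `[(2, -2), (2, -1), (2, 0), (2, 1)]`. [folklore] -/
theorem clawHOKLF_33_7 : ClawHOKLF 3 3 [(2, -2), (2, -1), (2, 0), (2, 1)] := by
  unfold ClawHOKLF; decide +kernel

/-- Kernel class `(3, 3, 3, 3)`, chunk 8 of the column of `E₁`: `[(3, -3), (3, -2), (3, -1), (3, 0)]`. [folklore] -/
theorem clawHOKLF_33_8 : ClawHOKLF 3 3 [(3, -3), (3, -2), (3, -1), (3, 0)] := by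
  unfold ClawHOKLF; decide +kernel

/-- **The rule succeeds on the kernel class `(3, 3, 3, 3)`** (the model's `ClawHOK`). [folklore] -/
theorem clawHOK_33 : ClawHOK 3 3 := by
  have h : hexPts = [(-3, 0), (-3, 1), (-3, 2), (-3, 3), (-2, -1)] ++ ([(-2, 0), (-2, 1), (-2, 2), (-2, 3), (-1, -2)] ++ ([(-1, -1), (-1, 0), (-1, 1), (-1, 2), (-1, 3)] ++ ([(0, -3), (0, -2), (0, -1), (0, 0), (0, 1)] ++
    ([(0, 2), (0, 3), (1, -3), (1, -2), (1, -1)] ++ ([(1, 0), (1, 1), (1, 2), (2, -3)] ++ ([(2, -2), (2, -1), (2, 0), (2, 1)] ++ [(3, -3), (3, -2), (3, -1), (3, 0)])))))) := by decide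
  have hs : 3 ≤ 3 := le_rfl
  unfold ClawHOK; rw [h]
  exact clawHOKL_append ((clawHOKL_iff_fast hs _).1 clawHOKLF_33_1) (clawHOKL_append ((clawHOKL_iff_fast hs _).1 clawHOKLF_33_2)
    (clawHOKL_append ((clawHOKL_iff_fast hs _).1 clawHOKLF_33_3) (clawHOKL_append ((clawHOKL_iff_fast hs _).1 clawHOKLF_33_4)
    (clawHOKL_append ((clawHOKL_iff_fast hs _).1 clawHOKLF_33_5) (clawHOKL_append ((clawHOKL_iff_fast hs _).1 clawHOKLF_33_6)
    (clawHOKL_append ((clawHOKL_iff_fast hs _).1 clawHOKLF_33_7) ((clawHOKL_iff_fast hs _).1 clawHOKLF_33_8)))))))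

end Bcc111Claw

end Summit.CriticalPhenomena.PercolationContinuityZ3.Theorems.Transplant
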